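import Literature.Barriers.CriticalPhenomena.PlaquetteWalkHoleRootRootNotchEast
import Literature.Barriers.CriticalPhenomena.PlaquetteWalkHoleRootNearCells
import HarnessLib

/-!
# Barrier catalogue (SAWScalingLimit): THE ROOT NOTCH AT THE EAST WALL — witnesses and the one-route sign theorems

Leaf of `PlaquetteWalkHoleRootRootNotchEast` (`rootS` absent + bottom line of the root row shut east of the root plaquette
⇒ no wound under-walk; `rootN` twin; the generic one-route sign theorems) and `PlaquetteWalkHoleRootNearCells` (the landed
witnesses `nearBlockSO2` — over, `w₂`-free, avoiding `rootS` — and `nearBlockNU1` — under, `w₁`-free, avoiding `rootN` —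
both inside `[1,5]×[0,4]`). Setting: the `m × n` box `boxMinus m n [h, c]` whose LAST column is the column of the root
plaquette's eastern neighbour (`h.1 + 3 = m`), hole `h`, root plaquette `(h.1 + 1, h.2)` rooted at `W`, far cell
`(h.1 − 1, h.2)`.

§1 Two kit witnesses fitting the frame `[1,5]×[0,4]` with the east side cut (kit j295595 of the lane, tasks `((4,1),) ON1 I5`
and `((4,3),) US2 I5`, 20 arcs each; #878 every-position pattern): `notchBlockEO1` — over, `w₁`-free, AVOIDING `rootS (4,1)`;
`notchBlockEU2` — under, `w₂`-free, AVOIDING `rootN (4,3)` (its row mirror).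
§2 ★★★★★ `lawL_box_eastRootE_rootS_im_vertexFunctional_pos` — `h.1 + 3 = m`, `2 ≤ h.1`, `2 ≤ h.2`, `h.2 + 3 ≤ n`, `rootS`
removed ⇒ `Im VF(θ) > 0` on the WHOLE range `[π/3, 2π/3]` (under route EMPTY, `P₁ ∧ P₃` of LAW L vacuously; over witnesses
`nearBlockSO2`, `notchBlockEO1` ⇒ `¬P₂ ∧ ¬P₄`); ★★★★★ `lawL_box_eastRootE_rootN_im_vertexFunctional_neg` — the twin (`rootN`
removed ⇒ `Im VF < 0`; under witnesses `notchBlockEU2`, `nearBlockNU1`). Compare `PlaquetteWalkHoleRootEastWall` (root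
plaquette ON the east wall, `h.1 + 2 = m`: `VF ≡ 0`) and `PlaquetteWalkHoleRootNearCells` (`h.1 + 4 ≤ m`, three free rows:
`rootS`/`rootN` harmless): the column of `rootE` being the last one is exactly what lets a root notch empty its route.

Not in print; venture lane «pcv-sawmu», seat b-step0 gen 28 (FINDING-YB-KILL-FORCED-ZEROS §22 addendum, §24).

References: A. Glazman, I. Manolescu, arXiv:1708.00395v3, §1 (Fig. 1, Fig. 2, remark after eq. (1)), §2.1, §4.2, Lemma 2.1
[GlazmanManolescu2019]; A. Glazman, Electron. Commun. Probab. 20 (2015) no. 86, Lemma 3.1, proof pp. 6–7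
[Glazman2015WeightedSAW]; R. Courant, H. Robbins, *What is Mathematics?* (1941/1958), Ch. V Appendix §2 (the even–odd
rule) [CourantRobbins1958].
-/

noncomputable section

open Set Function Complex

namespace Literature.Barriers.CriticalPhenomena.PlaquetteWalk

open Literature.Probability.RandomPlanarGeometry.SAW.YangBaxter
open Real Complex

/-! ## §1 The two witnesses (reference root `w42 = (4, 2)`, hole `(3, 2)`, far cell `(2, 2)`) -/

section Witnesses

/-- Root-notch witness block `EO1`: the 20 cells of an over w₁-free wound witness (reference root `(4, 2)`, hole
`(3, 2)`, far cell `(2, 2)`) AVOIDING `rootS (4,1)` (and `holeS (3,1)`); cells in `[1,5]×[0,4]` (kit j295595 of the lane).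
[cite: GlazmanManolescu2019, §2.1 (finite domains of faces)] -/
def notchBlockEO142 : List Face := [(1,2),(1,3),(1,4),(2,0),(2,1),(2,2),(2,3),(2,4),(3,0),(3,3),(3,4),(4,0),(4,2),(4,3),(4,4),(5,0),(5,1),(5,2),(5,3),(5,4)]

/-- Its mid-edges (20 arcs). [cite: GlazmanManolescu2019, §1 (definition of the model), Fig. 1] -/
def notchEO1Mids : List MidEdge :=
  [.vert 4 2, .slant 4 3, .vert 4 3, .vert 3 3, .slant 2 3, .vert 2 2, .slant 1 3, .slant 1 4, .vert 2 4, .vert 3 4, .vert 4 4, .vert 5 4, .slant 5 4, .slant 5 3, .slant 5 2, .slant 5 1, .vert 5 0, .vert 4 0, .vert 3 0, .slant 2 1, .slant 2 2]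

/-- The witness as a walk of its block. [cite: GlazmanManolescu2019, §1 (definition of the model), Fig. 1] -/
def notchEO1Walk : YBWalk (dom notchBlockEO142) (w42.side .W) ((farW w42).side .S) where
  mids := notchEO1Mids
  head_eq := by decide
  getLast_eq := by decide
  nodup := by decide
  arc_mem := arc_mem_of_check (by decide)
  isChain := by decide
  noncross := noncross_of_check (by decide)

/-- The labelled witness. [cite: Glazman2015WeightedSAW, Lemma 3.1 (proof, pp. 6–7)] -/
def ωnotchEO1 : ΩG (dom notchBlockEO142) (w42.side .W) (farW w42) := ⟨.S, notchEO1Walk⟩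

/-- Certificates: first hit `4`, `20` arcs, no later far-cell arc, first side `N`, w₁-free off the far cell, odd
eastern-ray count (`1`). [cite: Glazman2015WeightedSAW, Lemma 3.1 (proof, pp. 6–7)] [cite: CourantRobbins1958, Ch. V Appendix §2 (the even–odd rule)] -/
theorem ωnotchEO1_cert : ωnotchEO1.2.firstHitG = 4 ∧ ωnotchEO1.2.arcs.length = 20 ∧
    (∀ j < 20, 4 < j → ωnotchEO1.2.fc j ≠ farW w42) ∧ ωnotchEO1.2.nth 4 = (farW w42).side .N ∧
    ωnotchEO1.2.W1FreeOff (farW w42) ∧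
    Odd ((Finset.range 16).filter fun j => eastRayB w42 (ωnotchEO1.2.nth (4 + j + 1)) = true).card := by
  refine ⟨by decide, by decide, by decide, by decide, by unfold YBWalk.W1FreeOff; decide, by decide⟩

/-- The block at the root plaquette `w`. [cite: GlazmanManolescu2019, §2.1, §4.2 (translation invariance)] -/
def notchBlockEO1 (w : Face) : List Face := notchBlockEO142.map (Face.shiftBy (refShift w))

/-- ★★★ The over w₁-free wound witness `EO1` at EVERY POSITION: any face list containing the translated block
carries a wound class-`B2a` over-walk at the far cell, w₁-free off it. [cite: GlazmanManolescu2019, §4.2 (translation invariance), Lemma 2.1]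
[cite: Glazman2015WeightedSAW, Lemma 3.1 (proof, pp. 6–7)] [cite: CourantRobbins1958, Ch. V Appendix §2 (the even–odd rule)] -/
theorem exists_over_W1FreeOff_of_notchBlockEO1 {Dl : List Face} {w : Face} (hB : ∀ c ∈ notchBlockEO1 w, c ∈ Dl)
    (hr : RootedFace (dom Dl) (w.side .W) (farW w)) (θ : ℝ) :
    ∃ (ω : ΩG (dom Dl) (w.side .W) (farW w)) (h : ω.IsB2a), ω.2.firstSideG = .N ∧
      ω.WE (fun _ => θ) ≠ excursionWinding θ ω.2.firstSideG (ω.z1 hr h) ω.1 ∧ ω.2.W1FreeOff (farW w) := by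
  have hB₀ := block42_mem_of_block_mem (B := notchBlockEO142) hB
  obtain ⟨hF, hn, hfc, hnth, hfree, hodd⟩ := ωnotchEO1_cert
  let ω₀ : ΩG (dom (Dl.map (Face.shiftBy (-refShift w)))) (w42.side .W) (farW w42) :=
    ⟨.S, notchEO1Walk.mapDomain fun c hc => hB₀ c hc⟩
  have hF' : ω₀.2.firstHitG = 4 := hF
  have hn' : ω₀.2.arcs.length = 20 := hn
  have h₀ : ω₀.IsB2a := by
    refine ΩG.isB2a_of_forall_fc_ne (by rw [hF', hn']; omega) fun j hj1 hj2 => ?_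
    rw [hF'] at hj1
    rw [hn'] at hj2
    exact hfc j hj2 hj1
  have hM : ω₀.Mv = 16 := by unfold ΩG.Mv; rw [hF', hn']
  exact exists_wound_witness_shift (shiftBy_refShift_root w) (shiftBy_refShift_farW w) hr
    (fun γ r => γ.W1FreeOff r) (fun hm _ hf => YBWalk.W1FreeOff_of_mids_shift hm hf) ω₀ h₀
    (by rw [hF']; exact hnth) hfree (by rw [hM, hF']; exact hodd) θ

/-- Root-notch witness block `EU2`: the 20 cells of an under w₂-free wound witness (reference root `(4, 2)`, hole
`(3, 2)`, far cell `(2, 2)`) AVOIDING `rootN (4,3)` (and `holeN (3,3)`) — the row mirror of `EO1`; cells in `[1,5]×[0,4]` (kit j295595 of the lane).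
[cite: GlazmanManolescu2019, §2.1 (finite domains of faces)] -/
def notchBlockEU242 : List Face := [(1,0),(1,1),(1,2),(2,0),(2,1),(2,2),(2,3),(2,4),(3,0),(3,1),(3,4),(4,0),(4,1),(4,2),(4,4),(5,0),(5,1),(5,2),(5,3),(5,4)]

/-- Its mid-edges (20 arcs). [cite: GlazmanManolescu2019, §1 (definition of the model), Fig. 1] -/
def notchEU2Mids : List MidEdge :=
  [.vert 4 2, .slant 4 2, .vert 4 1, .vert 3 1, .slant 2 2, .vert 2 2, .slant 1 2, .slant 1 1, .vert 2 0, .vert 3 0, .vert 4 0, .vert 5 0, .slant 5 1, .slant 5 2, .slant 5 3, .slant 5 4, .vert 5 4, .vert 4 4, .vert 3 4, .slant 2 4, .slant 2 3]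

/-- The witness as a walk of its block. [cite: GlazmanManolescu2019, §1 (definition of the model), Fig. 1] -/
def notchEU2Walk : YBWalk (dom notchBlockEU242) (w42.side .W) ((farW w42).side .N) where
  mids := notchEU2Mids
  head_eq := by decide
  getLast_eq := by decide
  nodup := by decide
  arc_mem := arc_mem_of_check (by decide)
  isChain := by decide
  noncross := noncross_of_check (by decide)

/-- The labelled witness. [cite: Glazman2015WeightedSAW, Lemma 3.1 (proof, pp. 6–7)] -/
def ωnotchEU2 : ΩG (dom notchBlockEU242) (w42.side .W) (farW w42) := ⟨.N, notchEU2Walk⟩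

/-- Certificates: first hit `4`, `20` arcs, no later far-cell arc, first side `S`, w₂-free off the far cell, odd
eastern-ray count (`1`). [cite: Glazman2015WeightedSAW, Lemma 3.1 (proof, pp. 6–7)] [cite: CourantRobbins1958, Ch. V Appendix §2 (the even–odd rule)] -/
theorem ωnotchEU2_cert : ωnotchEU2.2.firstHitG = 4 ∧ ωnotchEU2.2.arcs.length = 20 ∧
    (∀ j < 20, 4 < j → ωnotchEU2.2.fc j ≠ farW w42) ∧ ωnotchEU2.2.nth 4 = (farW w42).side .S ∧
    ωnotchEU2.2.W2FreeOff (farW w42) ∧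
    Odd ((Finset.range 16).filter fun j => eastRayB w42 (ωnotchEU2.2.nth (4 + j + 1)) = true).card := by
  refine ⟨by decide, by decide, by decide, by decide, by unfold YBWalk.W2FreeOff; decide, by decide⟩

/-- The block at the root plaquette `w`. [cite: GlazmanManolescu2019, §2.1, §4.2 (translation invariance)] -/
def notchBlockEU2 (w : Face) : List Face := notchBlockEU242.map (Face.shiftBy (refShift w))

/-- ★★★ The under w₂-free wound witness `EU2` at EVERY POSITION: any face list containing the translated block
carries a wound class-`B2a` under-walk at the far cell, w₂-free off it. [cite: GlazmanManolescu2019, §4.2 (translation invariance), Lemma 2.1]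
[cite: Glazman2015WeightedSAW, Lemma 3.1 (proof, pp. 6–7)] [cite: CourantRobbins1958, Ch. V Appendix §2 (the even–odd rule)] -/
theorem exists_under_W2FreeOff_of_notchBlockEU2 {Dl : List Face} {w : Face} (hB : ∀ c ∈ notchBlockEU2 w, c ∈ Dl)
    (hr : RootedFace (dom Dl) (w.side .W) (farW w)) (θ : ℝ) :
    ∃ (ω : ΩG (dom Dl) (w.side .W) (farW w)) (h : ω.IsB2a), ω.2.firstSideG = .S ∧
      ω.WE (fun _ => θ) ≠ excursionWinding θ ω.2.firstSideG (ω.z1 hr h) ω.1 ∧ ω.2.W2FreeOff (farW w) := by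
  have hB₀ := block42_mem_of_block_mem (B := notchBlockEU242) hB
  obtain ⟨hF, hn, hfc, hnth, hfree, hodd⟩ := ωnotchEU2_cert
  let ω₀ : ΩG (dom (Dl.map (Face.shiftBy (-refShift w)))) (w42.side .W) (farW w42) :=
    ⟨.N, notchEU2Walk.mapDomain fun c hc => hB₀ c hc⟩
  have hF' : ω₀.2.firstHitG = 4 := hF
  have hn' : ω₀.2.arcs.length = 20 := hn
  have h₀ : ω₀.IsB2a := by
    refine ΩG.isB2a_of_forall_fc_ne (by rw [hF', hn']; omega) fun j hj1 hj2 => ?_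
    rw [hF'] at hj1
    rw [hn'] at hj2
    exact hfc j hj2 hj1
  have hM : ω₀.Mv = 16 := by unfold ΩG.Mv; rw [hF', hn']
  exact exists_wound_witness_shift (shiftBy_refShift_root w) (shiftBy_refShift_farW w) hr
    (fun γ r => γ.W2FreeOff r) (fun hm _ hf => YBWalk.W2FreeOff_of_mids_shift hm hf) ω₀ h₀
    (by rw [hF']; exact hnth) hfree (by rw [hM, hF']; exact hodd) θ

end Witnesses

/-! ## §2 The one-route sign theorems for the root plaquette's eastern neighbour in the last column -/

section Boxes

variable {m n : ℕ} {h : Face}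

/-- ★★★★★ **ROOT NOTCH BELOW, `rootE` IN THE LAST COLUMN: `Im VF > 0` ON THE WHOLE RANGE `[π/3, 2π/3]`** — hence `VF ≠ 0`
there and, in the language of LAW L, `P₁ ∧ P₃` (the under route is EMPTY) while `P₂`, `P₄` fail. Box `m × n` with
`h.1 + 3 = m`, `2 ≤ h.1`, `2 ≤ h.2`, `h.2 + 3 ≤ n`, `rootS = (h.1 + 1, h.2 − 1)` removed; over witnesses `nearBlockSO2`
(`w₂`-free) and `notchBlockEO1` (`w₁`-free), both inside `[1,5]×[0,4]` and avoiding `rootS`.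
[cite: GlazmanManolescu2019, Lemma 2.1 (statement, "in the form given in [Gl]"), §1 eq. (1), §2.1]
[cite: Glazman2015WeightedSAW, Lemma 3.1 (proof, pp. 6–7)] [cite: CourantRobbins1958, Ch. V Appendix §2 (the even–odd rule)] -/
theorem lawL_box_eastRootE_rootS_im_vertexFunctional_pos (hW : 2 ≤ h.1) (hE3 : h.1 + 3 = m) (hS : 2 ≤ h.2) (hN : h.2 + 3 ≤ n)
    {θ : ℝ} (hθ : θ ∈ Set.Icc (π / 3) (2 * π / 3)) :
    0 < (vertexFunctional (printedWeights θ) tFiveEighths (ybCoeff θ) (boxMinus m n [h, (h.1 + 1, h.2 - 1)])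
      (Face.side (h.1 + 1, h.2) .W) (farW (h.1 + 1, h.2))).im := by
  have sub := block_hroot_subset_boxMinus_of_bounds (m := m) (n := n) (h := h)
  have hh : h ∈ [h, (h.1 + 1, h.2 - 1)] := by simp
  have hfS : ((h.1 - 1, h.2) : Face) ∉ [h, (h.1 + 1, h.2 - 1)] := by
    rw [List.mem_cons, List.mem_singleton, not_or]
    exact ⟨fun e => by have := (Prod.ext_iff.1 e).1; simp only at this; omega,
      fun e => by have := (Prod.ext_iff.1 e).1; simp only at this; omega⟩
  have hf := farW_hroot_mem_boxMinus_of_not_mem (m := m) (n := n) (by omega) (by omega) (by omega) (by omega) hfS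
  have hr := rootedFace_hroot_boxMinus_of_mem hf hh
  have hhD : holeFaceW ((h.1 + 1, h.2) : Face) ∉ dom (boxMinus m n [h, (h.1 + 1, h.2 - 1)]) := by
    rw [holeFaceW_hroot]; exact not_mem_dom_boxMinus_of_mem hh
  refine im_vertexFunctional_printed_pos_of_under_unwound hθ hf hhD hr
    (fun θ' ω hb hs => lawL_box_eastRootE_rootS_not_wound_under (by omega) hE3 (by omega) (by omega) hh hfS
      (by simp) ω hb hs θ')
    (exists_over_W2FreeOff_of_nearBlockSO2 (sub nearBlockSO242 1 5 0 4 4 1 (by decide) (by omega) (by omega)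
      (by omega) (by omega) ⟨by omega, by omega⟩) hr)
    (exists_over_W1FreeOff_of_notchBlockEO1 (sub notchBlockEO142 1 5 0 4 4 1 (by decide) (by omega) (by omega)
      (by omega) (by omega) ⟨by omega, by omega⟩) hr)

/-- ★★★★★ **ROOT NOTCH ABOVE, `rootE` IN THE LAST COLUMN: `Im VF < 0` ON THE WHOLE RANGE** (`rootN = (h.1 + 1, h.2 + 1)`
removed; the over route is EMPTY — `P₂ ∧ P₄` vacuously — and the under witnesses `notchBlockEU2` (`w₂`-free),
`nearBlockNU1` (`w₁`-free) fit `[1,5]×[0,4]` avoiding `rootN`). The lane's «east-column `rootN`» emptiness of the thin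
census, typed for all boxes. [cite: GlazmanManolescu2019, Lemma 2.1 (statement, "in the form given in [Gl]"), §1 eq. (1), §2.1]
[cite: Glazman2015WeightedSAW, Lemma 3.1 (proof, pp. 6–7)] [cite: CourantRobbins1958, Ch. V Appendix §2 (the even–odd rule)] -/
theorem lawL_box_eastRootE_rootN_im_vertexFunctional_neg (hW : 2 ≤ h.1) (hE3 : h.1 + 3 = m) (hS : 2 ≤ h.2) (hN : h.2 + 3 ≤ n)
    {θ : ℝ} (hθ : θ ∈ Set.Icc (π / 3) (2 * π / 3)) :
    (vertexFunctional (printedWeights θ) tFiveEighths (ybCoeff θ) (boxMinus m n [h, (h.1 + 1, h.2 + 1)])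
      (Face.side (h.1 + 1, h.2) .W) (farW (h.1 + 1, h.2))).im < 0 := by
  have sub := block_hroot_subset_boxMinus_of_bounds (m := m) (n := n) (h := h)
  have hh : h ∈ [h, (h.1 + 1, h.2 + 1)] := by simp
  have hfS : ((h.1 - 1, h.2) : Face) ∉ [h, (h.1 + 1, h.2 + 1)] := by
    rw [List.mem_cons, List.mem_singleton, not_or]
    exact ⟨fun e => by have := (Prod.ext_iff.1 e).1; simp only at this; omega,
      fun e => by have := (Prod.ext_iff.1 e).1; simp only at this; omega⟩
  have hf := farW_hroot_mem_boxMinus_of_not_mem (m := m) (n := n) (by omega) (by omega) (by omega) (by omega) hfS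
  have hr := rootedFace_hroot_boxMinus_of_mem hf hh
  have hhD : holeFaceW ((h.1 + 1, h.2) : Face) ∉ dom (boxMinus m n [h, (h.1 + 1, h.2 + 1)]) := by
    rw [holeFaceW_hroot]; exact not_mem_dom_boxMinus_of_mem hh
  refine im_vertexFunctional_printed_neg_of_over_unwound hθ hf hhD hr
    (fun θ' ω hb hs => lawL_box_eastRootE_rootN_not_wound_over (by omega) hE3 (by omega) (by omega) hh hfS
      (by simp) ω hb hs θ')
    (exists_under_W2FreeOff_of_notchBlockEU2 (sub notchBlockEU242 1 5 0 4 4 3 (by decide) (by omega) (by omega)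
      (by omega) (by omega) ⟨by omega, by omega⟩) hr)
    (exists_under_W1FreeOff_of_nearBlockNU1 (sub nearBlockNU142 1 5 0 4 4 3 (by decide) (by omega) (by omega)
      (by omega) (by omega) ⟨by omega, by omega⟩) hr)

end Boxes

end Literature.Barriers.CriticalPhenomena.PlaquetteWalk
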